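import Literature.Geometry.Riemannian.GeneralizedCylinderScalarCurvature
import Literature.Analysis.Calculus.MatrixFieldDeriv
import HarnessLib

/-!
# Generalized cylinders: `∂_t H_t = -Ric(∂_t, ∂_t) - |K_t|²` and the scalar curvature formula
# (Bär–Gauduchon–Moroianu 2005, Prop. 4.1; Bär–Hanke 2023, §3, (9))

Topic `Literature/Geometry/Riemannian`; sequel of `GeneralizedCylinderScalarCurvature.lean`, a
brick of the proof programme of `Literature.Geometry.Riemannian.BaerHankePscGluing`. For a
Riemannian generalized cylinder `(N × ℝ, G = g_t + dt²)` (cylinder property `hcyl`), with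
`g_t = ι_t^* G`, `K_t` the second fundamental form of the slice `ι_t` w.r.t. `∂_t` (`ġ_t = 2K_t`),
`H_t = tr_{g_t} K_t` its mean curvature and `|K_t|²` its square norm:

* `hasDerivAt_cyl_meanCurvature` — **the traced Riccati (Raychaudhuri) equation**
  `∂_t H_t(z) = -Ric_G(∂_t, ∂_t)(z, t) - |K_t|²(z)` (O'Neill 1983, Ch. 8; BGM 2005, §4): in a
  `g_t`-orthogonal basis `β` of `T_zN`, `H_τ = ∑ (𝒢_τ⁻¹)ⱼᵢ K_τ(βᵢ, βⱼ)` (`trace_eq_sum_gram_inv`)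
  with `𝒢_τ = (g_τ(βᵢ, βⱼ))`; differentiate with `∂_τ 𝒢 = K + Kᵀ` (`hasDerivAt_cyl_val`),
  `∂_τ 𝒢⁻¹ = -𝒢⁻¹ (∂_τ𝒢) 𝒢⁻¹` (`hasFDerivAt_inv_apply`) and the Riccati identity for the
  diagonal entries (`hasDerivAt_cyl_sum_secondFundamentalForm_div`, off-diagonal entries by
  polarization, `K_τ` being symmetric);
* `cyl_scalarCurvature_eq` — **the scalar curvature of a generalized cylinder**
  (BGM 2005, Prop. 4.1; Bär–Hanke 2023, (9)):
  `scal_G(z, t) = scal_{g_t}(z) - |K_t|²(z) - H_t(z)² - 2 ∂_t H_t(z)`, from the traced Gauss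
  equation (`scalarCurvature_eq_of_inducedMetric_general`) and the Raychaudhuri equation. With
  `ġ_t = 2K_t`, `g̈_t = 2K̇_t` this is Bär–Hanke's printed form
  `scal_G = scal_{g_t} + 3 tr(W_t²) - tr(W_t)² - tr_{g_t}(g̈_t)`, `W_t = -K_t^♯`.

Everything is proved; no definitions, no named facts (D-0026).

## References

* C. Bär, P. Gauduchon, A. Moroianu, *Generalized cylinders in semi-Riemannian and spin
  geometry*, Math. Z. 249 (2005) 545–580, Prop. 4.1. [folklore]
* C. Bär, B. Hanke, *Boundary conditions for scalar curvature*, arXiv:2012.09127, §3, (9).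
  [BarHanke2023]
* B. O'Neill, *Semi-Riemannian geometry* (1983), Ch. 4, Cor. 4.6 (traced Gauss equation);
  Ch. 8 (Riccati/Raychaudhuri). [ONeill1983]
-/

noncomputable section

open Bundle Set Filter Function Metric
open scoped Manifold ContDiff Topology

namespace Literature.Geometry.Riemannian

open Literature.Geometry.Lorentzian
open Literature.Geometry.Lorentzian.PseudoRiemannianMetric

variable {E' : Type*} [NormedAddCommGroup E'] [NormedSpace ℝ E'] [FiniteDimensional ℝ E']
  {H' : Type*} [TopologicalSpace H'] {I' : ModelWithCorners ℝ E' H'} [I'.Boundaryless]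
  {N : Type*} [TopologicalSpace N] [ChartedSpace H' N] [IsManifold I' ∞ N]
  (G : PseudoRiemannianMetric (I'.prod 𝓘(ℝ, ℝ)) ∞ (E' × ℝ)
    (TangentSpace (I'.prod 𝓘(ℝ, ℝ)) : N × ℝ → Type _)) [G.HasLeviCivita]

/-- **Symmetry of the second fundamental forms of the slices of a generalized cylinder**
(`secondFundamentalForm_symm_holds`: `∂_t` is normal to the slices, everything is smooth).
[cite: ONeill1983, Ch. 4, Lemma 4.4] -/
theorem cyl_secondFundamentalForm_symm
    (hcyl : ∀ (p : N × ℝ) (v w : TangentSpace (I'.prod 𝓘(ℝ, ℝ)) p),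
      G.val p v w = G.val p ((v.1, 0) : TangentSpace (I'.prod 𝓘(ℝ, ℝ)) p)
        ((w.1, 0) : TangentSpace (I'.prod 𝓘(ℝ, ℝ)) p) + v.2 * w.2)
    (z : N) (τ : ℝ) (v w : TangentSpace I' z) :
    G.secondFundamentalForm I' (fun y : N ↦ ((y, τ) : N × ℝ))
        (fun y ↦ velocity (I'.prod 𝓘(ℝ, ℝ)) (fun s : ℝ ↦ ((y, s) : N × ℝ)) τ) z v w =
      G.secondFundamentalForm I' (fun y : N ↦ ((y, τ) : N × ℝ))
        (fun y ↦ velocity (I'.prod 𝓘(ℝ, ℝ)) (fun s : ℝ ↦ ((y, s) : N × ℝ)) τ) z w v := by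
  have hF2 : ContMDiff I' (I'.prod 𝓘(ℝ, ℝ)) 2 (fun y : N ↦ ((y, τ) : N × ℝ)) :=
    (contMDiff_cylSlice (I' := I') τ).of_le (by exact WithTop.coe_le_coe.2 le_top)
  have hν1 : ContMDiff I' (I'.prod 𝓘(ℝ, ℝ)).tangent 1 (fun y : N ↦
      (TotalSpace.mk' (E' × ℝ) ((y, τ) : N × ℝ)
        (velocity (I'.prod 𝓘(ℝ, ℝ)) (fun s : ℝ ↦ ((y, s) : N × ℝ)) τ) :
          TangentBundle (I'.prod 𝓘(ℝ, ℝ)) (N × ℝ))) :=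
    (contMDiff_lift_velocity_cylSlice (I' := I') (N := N) τ).of_le
      (by exact WithTop.coe_le_coe.2 le_top)
  exact (secondFundamentalForm_symm_holds (g := G) (I' := I') hF2
    (isUnitNormal_cylSlice G hcyl τ).1 hν1 BoundarylessManifold.isInteriorPoint).eq v w

set_option maxHeartbeats 1600000 in
/-- **The Raychaudhuri / traced Riccati equation on a generalized cylinder**
(O'Neill 1983, Ch. 8; Bär–Gauduchon–Moroianu 2005, §4): for `G = g_t + dt²` Riemannian with the
cylinder property, the mean curvature `H_τ(z) = tr_{g_τ} K_τ(z)` of the slices through `z`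
satisfies `(d/dτ)|_{τ=t} H_τ(z) = -(|K_t|²_{g_t}(z) + Ric_G(∂_t, ∂_t)(z, t))`.
[cite: BarHanke2023, §3, (9)] -/
theorem hasDerivAt_cyl_meanCurvature (hG : G.IsRiemannian)
    (hcyl : ∀ (p : N × ℝ) (v w : TangentSpace (I'.prod 𝓘(ℝ, ℝ)) p),
      G.val p v w = G.val p ((v.1, 0) : TangentSpace (I'.prod 𝓘(ℝ, ℝ)) p)
        ((w.1, 0) : TangentSpace (I'.prod 𝓘(ℝ, ℝ)) p) + v.2 * w.2)
    (z : N) (t : ℝ) :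
    HasDerivAt (fun τ ↦ G.meanCurvature (fun y : N ↦ ((y, τ) : N × ℝ))
        (contMDiff_pullbackBilin_holds (I := I'.prod 𝓘(ℝ, ℝ)) (M := N × ℝ) (I' := I') (N := N))
        (isSpacelikeImmersion_cylSlice G hG τ)
        (fun y ↦ velocity (I'.prod 𝓘(ℝ, ℝ)) (fun s : ℝ ↦ ((y, s) : N × ℝ)) τ) z)
      (-((G.inducedMetric (fun y : N ↦ ((y, t) : N × ℝ))
          (contMDiff_pullbackBilin_holds (I := I'.prod 𝓘(ℝ, ℝ)) (M := N × ℝ) (I' := I') (N := N))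
          (isSpacelikeImmersion_cylSlice G hG t)).normSq z
          (G.secondFundamentalForm I' (fun y : N ↦ ((y, t) : N × ℝ))
            (fun y ↦ velocity (I'.prod 𝓘(ℝ, ℝ)) (fun s : ℝ ↦ ((y, s) : N × ℝ)) t) z) +
        G.ricci (z, t) (((0 : E'), (1 : ℝ)) : TangentSpace (I'.prod 𝓘(ℝ, ℝ)) (z, t))
          (((0 : E'), (1 : ℝ)) : TangentSpace (I'.prod 𝓘(ℝ, ℝ)) (z, t)))) t := by
  classical
  set hpb := contMDiff_pullbackBilin_holds (I := I'.prod 𝓘(ℝ, ℝ)) (M := N × ℝ) (I' := I') (N := N)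
    (n := (∞ : ℕ∞ω)) with hpb_def
  have hfi := fun τ ↦ isSpacelikeImmersion_cylSlice G hG τ
  set gN := G.inducedMetric (fun y : N ↦ ((y, t) : N × ℝ)) hpb (hfi t) with hgN
  set K : ℝ → LinearMap.BilinForm ℝ (TangentSpace I' z) := fun τ ↦
    G.secondFundamentalForm I' (fun y : N ↦ ((y, τ) : N × ℝ))
      (fun y ↦ velocity (I'.prod 𝓘(ℝ, ℝ)) (fun s : ℝ ↦ ((y, s) : N × ℝ)) τ) z with hKdef
  have hKs : ∀ τ v w, K τ v w = K τ w v := fun τ v w ↦ cyl_secondFundamentalForm_symm G hcyl z τ v w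
  -- an orthogonal basis `β` of `(T_zN, g_t)` indexed by `Fin m`
  set m := Module.finrank ℝ E' with hm_def
  have hm : Module.finrank ℝ E' = m := rfl
  obtain ⟨e, he, hde⟩ := exists_isOrthoᵢ_basis gN z
  have hfin : Module.finrank ℝ (TangentSpace I' z) = m := rfl
  set β : Module.Basis (Fin m) ℝ (TangentSpace I' z) := e.reindex (finCongr hfin) with hβdef
  have hβapply : ∀ k, β k = e ((finCongr hfin).symm k) := fun k ↦ Module.Basis.reindex_apply _ _ _
  have hβ : (gN.toBilinForm z).IsOrthoᵢ β := by
    intro k l hkl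
    simp only [Function.onFun, hβapply]
    exact he fun h ↦ hkl ((finCongr hfin).symm.injective h)
  have hdβ : ∀ k, gN.val z (β k) (β k) ≠ 0 := fun k ↦ by rw [hβapply]; exact hde _
  -- Gram coefficients `𝒢_τ i j = G_{(z,τ)}((βᵢ,0), (βⱼ,0)) = g_τ(βᵢ, βⱼ)` and `aᵢ = 𝒢_t i i`
  set Gm : ℝ → Fin m → Fin m → ℝ := fun τ i j ↦ G.val (z, τ)
    ((β i, 0) : TangentSpace (I'.prod 𝓘(ℝ, ℝ)) (z, τ))
    ((β j, 0) : TangentSpace (I'.prod 𝓘(ℝ, ℝ)) (z, τ)) with hGm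
  set a : Fin m → ℝ := fun i ↦ Gm t i i with ha_def
  have hval : ∀ τ i j, (G.inducedMetric (fun y : N ↦ ((y, τ) : N × ℝ)) hpb (hfi τ)).val z (β i)
      (β j) = Gm τ i j := fun τ i j ↦ by
    show G.val (z, τ) (mfderiv I' (I'.prod 𝓘(ℝ, ℝ)) (fun y : N ↦ ((y, τ) : N × ℝ)) z (β i))
      (mfderiv I' (I'.prod 𝓘(ℝ, ℝ)) (fun y : N ↦ ((y, τ) : N × ℝ)) z (β j)) = Gm τ i j
    exact congrArg₂ (fun u u' ↦ G.val (z, τ) u u') (mfderiv_cylSlice_apply (E' := E') z τ (β i))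
      (mfderiv_cylSlice_apply (E' := E') z τ (β j))
  have ha : ∀ i, gN.val z (β i) (β i) = a i := fun i ↦ hval t i i
  have hd : ∀ i, a i ≠ 0 := fun i ↦ by rw [← ha i]; exact hdβ i
  -- (1) `H_τ = ∑ᵢⱼ (𝒢_τ⁻¹)ⱼᵢ K_τ(βᵢ, βⱼ)` for every `τ`
  have hmat : ∀ τ, (Matrix.of fun i j ↦ (G.inducedMetric (fun y : N ↦ ((y, τ) : N × ℝ)) hpb
      (hfi τ)).val z (β i) (β j)) = Matrix.of (Gm τ) := fun τ ↦ by
    ext i j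
    exact hval τ i j
  have hformula : (fun τ ↦ G.meanCurvature (fun y : N ↦ ((y, τ) : N × ℝ)) hpb (hfi τ)
      (fun y ↦ velocity (I'.prod 𝓘(ℝ, ℝ)) (fun s : ℝ ↦ ((y, s) : N × ℝ)) τ) z) =
      fun τ ↦ ∑ i, ∑ j, (Matrix.of (Gm τ))⁻¹ j i * K τ (β i) (β j) := by
    funext τ
    rw [meanCurvature, trace_eq_sum_gram_inv _ z β, hmat τ]
  -- (2a) `∂_τ 𝒢 = K + Kᵀ`
  have hGd : ∀ i j, HasDerivAt (fun τ ↦ Gm τ i j) (K t (β i) (β j) + K t (β j) (β i)) t :=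
    fun i j ↦ hasDerivAt_cyl_val G z t (β i) (β j)
  have hGpi : HasDerivAt Gm (fun i j ↦ K t (β i) (β j) + K t (β j) (β i)) t :=
    hasDerivAt_pi.2 fun i ↦ hasDerivAt_pi.2 fun j ↦ hGd i j
  -- (2b) `𝒢_t = diag(aᵢ)`, invertible
  have hG0 : Matrix.of (Gm t) = Matrix.diagonal a := by
    ext i j
    by_cases hij : i = j
    · subst hij; rw [Matrix.diagonal_apply_eq]; rfl
    · rw [Matrix.diagonal_apply_ne _ hij, Matrix.of_apply, ← hval t i j]
      exact hβ hij
  have hG0inv : (Matrix.of (Gm t))⁻¹ = Matrix.diagonal fun i ↦ (a i)⁻¹ := by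
    have h := gram_inv_of_isOrthoᵢ gN z β hβ hdβ
    rw [hmat t] at h
    rw [h]
    congr 1
    funext i
    rw [ha i]
  have hdet : (Matrix.of (Gm t)).det ≠ 0 := by
    rw [hG0, Matrix.det_diagonal]
    exact Finset.prod_ne_zero_iff.2 fun i _ ↦ hd i
  have hdiag2 : ∀ (X : Fin m → Fin m → ℝ) (j i : Fin m),
      ∑ k, ∑ l, (Matrix.diagonal fun i ↦ (a i)⁻¹) j k * (Matrix.diagonal fun i ↦ (a i)⁻¹) l i *
        X k l = (a j)⁻¹ * (a i)⁻¹ * X j i := by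
    intro X j i
    rw [Finset.sum_eq_single j]
    · rw [Finset.sum_eq_single i]
      · rw [Matrix.diagonal_apply_eq, Matrix.diagonal_apply_eq]
      · intro l _ hli
        rw [Matrix.diagonal_apply_ne _ hli, mul_zero, zero_mul]
      · intro h; exact absurd (Finset.mem_univ i) h
    · intro k _ hkj
      refine Finset.sum_eq_zero fun l _ ↦ ?_
      rw [Matrix.diagonal_apply_ne _ (Ne.symm hkj), zero_mul, zero_mul]
    · intro h; exact absurd (Finset.mem_univ j) h
  -- (2c) `∂_τ 𝒢⁻¹ = -𝒢⁻¹ (∂_τ𝒢) 𝒢⁻¹`, at `t` in closed form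
  have hGinv : ∀ j i, HasDerivAt (fun τ ↦ (Matrix.of (Gm τ))⁻¹ j i)
      (-((a j)⁻¹ * (a i)⁻¹ * (K t (β j) (β i) + K t (β i) (β j)))) t := fun j i ↦ by
    have h1 := (Literature.Analysis.Calculus.hasFDerivAt_inv_apply hGpi.hasFDerivAt hdet j
        i).hasDerivAt
    refine h1.congr_deriv ?_
    simp only [_root_.neg_apply, FunLike.coe_sum, Finset.sum_apply, FunLike.coe_smul,
      Pi.smul_apply, ContinuousLinearMap.coe_comp, Function.comp_apply,
      ContinuousLinearMap.proj_apply, smul_eq_mul,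
      ContinuousLinearMap.toSpanSingleton_apply, one_smul]
    rw [hG0inv, hdiag2]
  -- (2d) `∂_τ K_τ(βᵢ, βⱼ)`: Riccati identity on the diagonal, polarization off the diagonal
  set Q : TangentSpace I' z → ℝ := fun w ↦
    G.val (z, t) (G.leviCivita.curvature (z, t)
      (((0 : E'), (1 : ℝ)) : TangentSpace (I'.prod 𝓘(ℝ, ℝ)) (z, t))
      ((w, 0) : TangentSpace (I'.prod 𝓘(ℝ, ℝ)) (z, t))
      (((0 : E'), (1 : ℝ)) : TangentSpace (I'.prod 𝓘(ℝ, ℝ)) (z, t)))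
      ((w, 0) : TangentSpace (I'.prod 𝓘(ℝ, ℝ)) (z, t)) +
    G.val (z, t)
      (G.normalDerivAlong (I' := I') (fun y : N ↦ ((y, t) : N × ℝ))
        (fun y ↦ velocity (I'.prod 𝓘(ℝ, ℝ)) (fun s : ℝ ↦ ((y, s) : N × ℝ)) t) z w)
      (G.normalDerivAlong (I' := I') (fun y : N ↦ ((y, t) : N × ℝ))
        (fun y ↦ velocity (I'.prod 𝓘(ℝ, ℝ)) (fun s : ℝ ↦ ((y, s) : N × ℝ)) t) z w) with hQdef
  have hQ : ∀ w, HasDerivAt (fun τ ↦ K τ w w) (Q w) t := fun w ↦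
    hasDerivAt_cyl_secondFundamentalForm_self G hcyl z t w
  have hpol : ∀ i j, (fun τ ↦ K τ (β i) (β j)) = fun τ ↦
      (K τ (β i + β j) (β i + β j) - K τ (β i) (β i) - K τ (β j) (β j)) / 2 := by
    intro i j; funext τ
    have h := hKs τ (β j) (β i)
    simp only [map_add, LinearMap.add_apply]
    linarith
  set P : Fin m → Fin m → ℝ := fun i j ↦
    if i = j then Q (β i) else (Q (β i + β j) - Q (β i) - Q (β j)) / 2 with hPdef
  have hKd : ∀ i j, HasDerivAt (fun τ ↦ K τ (β i) (β j)) (P i j) t := by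
    intro i j
    by_cases hij : i = j
    · subst hij
      simp only [hPdef, if_true]
      exact hQ (β i)
    · rw [hpol i j]
      simp only [hPdef, if_neg hij]
      exact (((hQ (β i + β j)).sub (hQ (β i))).sub (hQ (β j))).div_const 2
  -- (2e) derivative of the double sum
  have hsum := HasDerivAt.fun_sum (u := Finset.univ) fun i _ ↦
    HasDerivAt.fun_sum (u := Finset.univ) fun j _ ↦ (hGinv j i).mul (hKd i j)
  rw [hformula]
  refine hsum.congr_deriv ?_
  -- (3) the algebra at `t`
  have hnorm : gN.normSq z (K t) = ∑ i, ∑ j, K t (β j) (β i) ^ 2 / (a i * a j) := by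
    rw [normSq_eq_sum_sq gN z β hβ hdβ (K t)]
    simp only [ha]
  -- the trace of the Riccati identity, by uniqueness of derivatives
  have htr : ∑ i, Q (β i) / a i =
      -G.ricci (z, t) (((0 : E'), (1 : ℝ)) : TangentSpace (I'.prod 𝓘(ℝ, ℝ)) (z, t))
          (((0 : E'), (1 : ℝ)) : TangentSpace (I'.prod 𝓘(ℝ, ℝ)) (z, t)) +
        gN.normSq z (K t) := by
    have h1 := hasDerivAt_cyl_sum_secondFundamentalForm_div G hG hcyl z t hm β hβ
    have h2 := HasDerivAt.fun_sum (u := Finset.univ) fun i _ ↦ (hQ (β i)).div_const (a i)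
    exact h2.unique h1
  have hfirst : ∑ i, ∑ j, -((a j)⁻¹ * (a i)⁻¹ * (K t (β j) (β i) + K t (β i) (β j))) *
      K t (β i) (β j) = -2 * gN.normSq z (K t) := by
    rw [hnorm, Finset.mul_sum]
    refine Finset.sum_congr rfl fun i _ ↦ ?_
    rw [Finset.mul_sum]
    refine Finset.sum_congr rfl fun j _ ↦ ?_
    rw [hKs t (β j) (β i)]
    have hai := hd i
    have haj := hd j
    field_simp
    ring
  have hsecond : ∑ i, ∑ j, (Matrix.diagonal fun i ↦ (a i)⁻¹) j i * P i j =
      ∑ i, Q (β i) / a i := by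
    refine Finset.sum_congr rfl fun i _ ↦ ?_
    rw [Finset.sum_eq_single i]
    · rw [Matrix.diagonal_apply_eq]
      simp only [hPdef, if_true]
      rw [inv_mul_eq_div]
    · intro j _ hji
      rw [Matrix.diagonal_apply_ne _ hji, zero_mul]
    · intro h; exact absurd (Finset.mem_univ i) h
  rw [hG0inv]
  simp only [Finset.sum_add_distrib]
  rw [hfirst, hsecond, htr]
  ring

/-- **The scalar curvature of a generalized cylinder** (Bär–Gauduchon–Moroianu 2005, Prop. 4.1;
Bär–Hanke 2023, §3, (9)): for `G = g_t + dt²` Riemannian with the cylinder property,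
`scal_G(z, t) = scal_{g_t}(z) - |K_t|²_{g_t}(z) - H_t(z)² - 2 (∂_τ|_{τ=t} H_τ(z))` — the traced
Gauss equation `scal_G = scal_{g_t} + 2Ric(∂_t,∂_t) - H² + |K|²`
(`scalarCurvature_eq_of_inducedMetric_general`) combined with the Raychaudhuri equation
`∂_t H = -Ric(∂_t,∂_t) - |K|²` (`hasDerivAt_cyl_meanCurvature`). Since `ġ_t = 2K_t`
(`hasDerivAt_cyl_val`) this is the printed
`scal_G = scal_{g_t} + 3 tr(W_t²) - tr(W_t)² - tr_{g_t} g̈_t` with `W_t = -K_t^♯`.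
[cite: BarHanke2023, §3, (9)] -/
theorem cyl_scalarCurvature_eq (hG : G.IsRiemannian)
    (hcyl : ∀ (p : N × ℝ) (v w : TangentSpace (I'.prod 𝓘(ℝ, ℝ)) p),
      G.val p v w = G.val p ((v.1, 0) : TangentSpace (I'.prod 𝓘(ℝ, ℝ)) p)
        ((w.1, 0) : TangentSpace (I'.prod 𝓘(ℝ, ℝ)) p) + v.2 * w.2)
    (z : N) (t : ℝ) :
    haveI := (G.inducedMetric (fun y : N ↦ ((y, t) : N × ℝ))
      (contMDiff_pullbackBilin_holds (I := I'.prod 𝓘(ℝ, ℝ)) (M := N × ℝ) (I' := I') (N := N))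
      (isSpacelikeImmersion_cylSlice G hG t)).hasLeviCivita
    G.scalarCurvature (z, t) =
      (G.inducedMetric (fun y : N ↦ ((y, t) : N × ℝ))
          (contMDiff_pullbackBilin_holds (I := I'.prod 𝓘(ℝ, ℝ)) (M := N × ℝ) (I' := I') (N := N))
          (isSpacelikeImmersion_cylSlice G hG t)).scalarCurvature z -
        (G.inducedMetric (fun y : N ↦ ((y, t) : N × ℝ))
          (contMDiff_pullbackBilin_holds (I := I'.prod 𝓘(ℝ, ℝ)) (M := N × ℝ) (I' := I') (N := N))
          (isSpacelikeImmersion_cylSlice G hG t)).normSq z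
          (G.secondFundamentalForm I' (fun y : N ↦ ((y, t) : N × ℝ))
            (fun y ↦ velocity (I'.prod 𝓘(ℝ, ℝ)) (fun s : ℝ ↦ ((y, s) : N × ℝ)) t) z) -
        G.meanCurvature (fun y : N ↦ ((y, t) : N × ℝ))
          (contMDiff_pullbackBilin_holds (I := I'.prod 𝓘(ℝ, ℝ)) (M := N × ℝ) (I' := I') (N := N))
          (isSpacelikeImmersion_cylSlice G hG t)
          (fun y ↦ velocity (I'.prod 𝓘(ℝ, ℝ)) (fun s : ℝ ↦ ((y, s) : N × ℝ)) t) z ^ 2 -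
        2 * deriv (fun τ ↦ G.meanCurvature (fun y : N ↦ ((y, τ) : N × ℝ))
          (contMDiff_pullbackBilin_holds (I := I'.prod 𝓘(ℝ, ℝ)) (M := N × ℝ) (I' := I') (N := N))
          (isSpacelikeImmersion_cylSlice G hG τ)
          (fun y ↦ velocity (I'.prod 𝓘(ℝ, ℝ)) (fun s : ℝ ↦ ((y, s) : N × ℝ)) τ) z) t := by
  set hpb := contMDiff_pullbackBilin_holds (I := I'.prod 𝓘(ℝ, ℝ)) (M := N × ℝ) (I' := I') (N := N)
    (n := (∞ : ℕ∞ω)) with hpb_def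
  have hfi := isSpacelikeImmersion_cylSlice G hG t
  have hν := contMDiff_lift_velocity_cylSlice (I' := I') (N := N) t
  have hun := isUnitNormal_cylSlice G hcyl t
  have hm1 : Module.finrank ℝ (E' × ℝ) = Module.finrank ℝ E' + 1 := finrank_cylModel
  have hGauss := scalarCurvature_eq_of_inducedMetric_general G hpb hfi hν hun rfl hm1 z
  rw [velocity_cylLine] at hGauss
  have hH := (hasDerivAt_cyl_meanCurvature G hG hcyl z t).deriv
  rw [hH, hGauss]
  ring

/-! ### The printed form: `scal_G = scal_{g_t} + 3|K_t|² - H_t² - tr_{g_t} g̈_t` -/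

/-- **`ġ_t = 2 K_t`** on a generalized cylinder: for `v, w ∈ T_zN` the coefficient
`τ ↦ g_τ(v, w) = G_{(z,τ)}((v,0),(w,0))` has derivative `2 K_t(v, w)` at every `t` (first
variation `hasDerivAt_cyl_val` and symmetry of `K_t`; Bär–Hanke 2023, (8): `II_t = -½ ġ_t`,
`II_t = -K_t`). [cite: BarHanke2023, §3, (8)] -/
theorem hasDerivAt_cyl_val_two_mul
    (hcyl : ∀ (p : N × ℝ) (v w : TangentSpace (I'.prod 𝓘(ℝ, ℝ)) p),
      G.val p v w = G.val p ((v.1, 0) : TangentSpace (I'.prod 𝓘(ℝ, ℝ)) p)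
        ((w.1, 0) : TangentSpace (I'.prod 𝓘(ℝ, ℝ)) p) + v.2 * w.2)
    (z : N) (t : ℝ) (v w : E') :
    HasDerivAt (fun τ ↦ G.val (z, τ) ((v, 0) : TangentSpace (I'.prod 𝓘(ℝ, ℝ)) (z, τ))
        ((w, 0) : TangentSpace (I'.prod 𝓘(ℝ, ℝ)) (z, τ)))
      (2 * G.secondFundamentalForm I' (fun y : N ↦ ((y, t) : N × ℝ))
          (fun y ↦ velocity (I'.prod 𝓘(ℝ, ℝ)) (fun s : ℝ ↦ ((y, s) : N × ℝ)) t) z v w) t := by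
  refine (hasDerivAt_cyl_val G z t v w).congr_deriv ?_
  rw [cyl_secondFundamentalForm_symm G hcyl z t w v, two_mul]

/-- `ġ` as a function: `deriv (τ ↦ g_τ(v, w)) = τ ↦ 2 K_τ(v, w)`. [cite: BarHanke2023, §3, (8)] -/
theorem deriv_cyl_val
    (hcyl : ∀ (p : N × ℝ) (v w : TangentSpace (I'.prod 𝓘(ℝ, ℝ)) p),
      G.val p v w = G.val p ((v.1, 0) : TangentSpace (I'.prod 𝓘(ℝ, ℝ)) p)
        ((w.1, 0) : TangentSpace (I'.prod 𝓘(ℝ, ℝ)) p) + v.2 * w.2)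
    (z : N) (v w : E') :
    deriv (fun τ ↦ G.val (z, τ) ((v, 0) : TangentSpace (I'.prod 𝓘(ℝ, ℝ)) (z, τ))
        ((w, 0) : TangentSpace (I'.prod 𝓘(ℝ, ℝ)) (z, τ))) =
      fun τ ↦ 2 * G.secondFundamentalForm I' (fun y : N ↦ ((y, τ) : N × ℝ))
        (fun y ↦ velocity (I'.prod 𝓘(ℝ, ℝ)) (fun s : ℝ ↦ ((y, s) : N × ℝ)) τ) z v w :=
  funext fun τ ↦ (hasDerivAt_cyl_val_two_mul G hcyl z τ v w).deriv

/-- **`g̈_t(w, w) = 2 K̇_t(w, w)`, with the Riccati identity**: the second derivative of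
`τ ↦ g_τ(w, w)` at `t` exists and equals `2 (G(R(∂_t,(w,0))∂_t,(w,0)) + G(D_w∂_t, D_w∂_t))`
(`deriv_cyl_val` and `hasDerivAt_cyl_secondFundamentalForm_self`). [cite: BarHanke2023, §3, (9)] -/
theorem hasDerivAt_deriv_cyl_val_self
    (hcyl : ∀ (p : N × ℝ) (v w : TangentSpace (I'.prod 𝓘(ℝ, ℝ)) p),
      G.val p v w = G.val p ((v.1, 0) : TangentSpace (I'.prod 𝓘(ℝ, ℝ)) p)
        ((w.1, 0) : TangentSpace (I'.prod 𝓘(ℝ, ℝ)) p) + v.2 * w.2)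
    (z : N) (t : ℝ) (w : E') :
    HasDerivAt (fun τ ↦ deriv (fun σ ↦ G.val (z, σ) ((w, 0) : TangentSpace (I'.prod 𝓘(ℝ, ℝ)) (z, σ))
        ((w, 0) : TangentSpace (I'.prod 𝓘(ℝ, ℝ)) (z, σ))) τ)
      (2 * (G.val (z, t)
          (G.leviCivita.curvature (z, t) (((0 : E'), (1 : ℝ)) : TangentSpace (I'.prod 𝓘(ℝ, ℝ)) (z, t))
            ((w, 0) : TangentSpace (I'.prod 𝓘(ℝ, ℝ)) (z, t))
            (((0 : E'), (1 : ℝ)) : TangentSpace (I'.prod 𝓘(ℝ, ℝ)) (z, t)))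
          ((w, 0) : TangentSpace (I'.prod 𝓘(ℝ, ℝ)) (z, t)) +
        G.val (z, t)
          (G.normalDerivAlong (I' := I') (fun y : N ↦ ((y, t) : N × ℝ))
            (fun y ↦ velocity (I'.prod 𝓘(ℝ, ℝ)) (fun s : ℝ ↦ ((y, s) : N × ℝ)) t) z w)
          (G.normalDerivAlong (I' := I') (fun y : N ↦ ((y, t) : N × ℝ))
            (fun y ↦ velocity (I'.prod 𝓘(ℝ, ℝ)) (fun s : ℝ ↦ ((y, s) : N × ℝ)) t) z w))) t := by
  rw [deriv_cyl_val G hcyl z w w]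
  exact (hasDerivAt_cyl_secondFundamentalForm_self G hcyl z t w).const_mul 2

/-- **The trace of the Riccati identity** (the content of
`hasDerivAt_cyl_sum_secondFundamentalForm_div`, by uniqueness of derivatives): in a
`g_t`-orthogonal basis `β` of `T_zN`,
`∑ᵢ (G(R(∂_t,βᵢ)∂_t,βᵢ) + |D_{βᵢ}∂_t|²)/aᵢ = -Ric_G(∂_t,∂_t) + |K_t|²`.
[cite: BarHanke2023, §3, (9)] -/
theorem cyl_sum_riccati_div_eq (hG : G.IsRiemannian)
    (hcyl : ∀ (p : N × ℝ) (v w : TangentSpace (I'.prod 𝓘(ℝ, ℝ)) p),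
      G.val p v w = G.val p ((v.1, 0) : TangentSpace (I'.prod 𝓘(ℝ, ℝ)) p)
        ((w.1, 0) : TangentSpace (I'.prod 𝓘(ℝ, ℝ)) p) + v.2 * w.2)
    (z : N) (t : ℝ) {m : ℕ} (hm : Module.finrank ℝ E' = m)
    (β : Module.Basis (Fin m) ℝ (TangentSpace I' z))
    (hβ : ((G.inducedMetric (fun y : N ↦ ((y, t) : N × ℝ))
      (contMDiff_pullbackBilin_holds (I := I'.prod 𝓘(ℝ, ℝ)) (M := N × ℝ) (I' := I') (N := N))
      (isSpacelikeImmersion_cylSlice G hG t)).toBilinForm z).IsOrthoᵢ β) :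
    ∑ i, (G.val (z, t)
          (G.leviCivita.curvature (z, t) (((0 : E'), (1 : ℝ)) : TangentSpace (I'.prod 𝓘(ℝ, ℝ)) (z, t))
            ((β i, 0) : TangentSpace (I'.prod 𝓘(ℝ, ℝ)) (z, t))
            (((0 : E'), (1 : ℝ)) : TangentSpace (I'.prod 𝓘(ℝ, ℝ)) (z, t)))
          ((β i, 0) : TangentSpace (I'.prod 𝓘(ℝ, ℝ)) (z, t)) +
        G.val (z, t)
          (G.normalDerivAlong (I' := I') (fun y : N ↦ ((y, t) : N × ℝ))
            (fun y ↦ velocity (I'.prod 𝓘(ℝ, ℝ)) (fun s : ℝ ↦ ((y, s) : N × ℝ)) t) z (β i))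
          (G.normalDerivAlong (I' := I') (fun y : N ↦ ((y, t) : N × ℝ))
            (fun y ↦ velocity (I'.prod 𝓘(ℝ, ℝ)) (fun s : ℝ ↦ ((y, s) : N × ℝ)) t) z (β i))) /
        G.val (z, t) ((β i, 0) : TangentSpace (I'.prod 𝓘(ℝ, ℝ)) (z, t))
          ((β i, 0) : TangentSpace (I'.prod 𝓘(ℝ, ℝ)) (z, t)) =
      -G.ricci (z, t) (((0 : E'), (1 : ℝ)) : TangentSpace (I'.prod 𝓘(ℝ, ℝ)) (z, t))
          (((0 : E'), (1 : ℝ)) : TangentSpace (I'.prod 𝓘(ℝ, ℝ)) (z, t)) +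
        (G.inducedMetric (fun y : N ↦ ((y, t) : N × ℝ))
          (contMDiff_pullbackBilin_holds (I := I'.prod 𝓘(ℝ, ℝ)) (M := N × ℝ) (I' := I') (N := N))
          (isSpacelikeImmersion_cylSlice G hG t)).normSq z
          (G.secondFundamentalForm I' (fun y : N ↦ ((y, t) : N × ℝ))
            (fun y ↦ velocity (I'.prod 𝓘(ℝ, ℝ)) (fun s : ℝ ↦ ((y, s) : N × ℝ)) t) z) := by
  have h1 := hasDerivAt_cyl_sum_secondFundamentalForm_div G hG hcyl z t hm β hβ
  have h2 := HasDerivAt.fun_sum (u := Finset.univ) fun i _ ↦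
    (hasDerivAt_cyl_secondFundamentalForm_self G hcyl z t (β i)).div_const
      (G.val (z, t) ((β i, 0) : TangentSpace (I'.prod 𝓘(ℝ, ℝ)) (z, t))
        ((β i, 0) : TangentSpace (I'.prod 𝓘(ℝ, ℝ)) (z, t)))
  exact h2.unique h1

/-- **The scalar curvature of a generalized cylinder, printed form** (Bär–Gauduchon–Moroianu
2005, Prop. 4.1; Bär–Hanke 2023, §3, (9): `scal_g = scal_{g_t} + 3 tr(W_t²) - tr(W_t)² -
tr_{g_t}(g̈_t)`, `W_t = -K_t^♯`): for `G = g_t + dt²` Riemannian with the cylinder property and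
any `g_t`-orthogonal basis `β` of `T_zN` with `aᵢ = g_t(βᵢ, βᵢ)`,
`scal_G(z,t) = scal_{g_t}(z) + 3|K_t|² - H_t² - ∑ᵢ g̈_t(βᵢ,βᵢ)/aᵢ`, where
`g̈_t(βᵢ,βᵢ) = (d²/dτ²)|_{τ=t} G_{(z,τ)}((βᵢ,0),(βᵢ,0))` and `∑ᵢ g̈_t(βᵢ,βᵢ)/aᵢ = tr_{g_t} g̈_t`.
Proof: traced Gauss equation (`scalarCurvature_eq_of_inducedMetric_general`), `g̈ = 2K̇`
(`hasDerivAt_deriv_cyl_val_self`) and the traced Riccati identity (`cyl_sum_riccati_div_eq`).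
[cite: BarHanke2023, §3, (9)] -/
theorem cyl_scalarCurvature_eq_sum (hG : G.IsRiemannian)
    (hcyl : ∀ (p : N × ℝ) (v w : TangentSpace (I'.prod 𝓘(ℝ, ℝ)) p),
      G.val p v w = G.val p ((v.1, 0) : TangentSpace (I'.prod 𝓘(ℝ, ℝ)) p)
        ((w.1, 0) : TangentSpace (I'.prod 𝓘(ℝ, ℝ)) p) + v.2 * w.2)
    (z : N) (t : ℝ) {m : ℕ} (hm : Module.finrank ℝ E' = m)
    (β : Module.Basis (Fin m) ℝ (TangentSpace I' z))
    (hβ : ((G.inducedMetric (fun y : N ↦ ((y, t) : N × ℝ))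
      (contMDiff_pullbackBilin_holds (I := I'.prod 𝓘(ℝ, ℝ)) (M := N × ℝ) (I' := I') (N := N))
      (isSpacelikeImmersion_cylSlice G hG t)).toBilinForm z).IsOrthoᵢ β) :
    haveI := (G.inducedMetric (fun y : N ↦ ((y, t) : N × ℝ))
      (contMDiff_pullbackBilin_holds (I := I'.prod 𝓘(ℝ, ℝ)) (M := N × ℝ) (I' := I') (N := N))
      (isSpacelikeImmersion_cylSlice G hG t)).hasLeviCivita
    G.scalarCurvature (z, t) =
      (G.inducedMetric (fun y : N ↦ ((y, t) : N × ℝ))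
          (contMDiff_pullbackBilin_holds (I := I'.prod 𝓘(ℝ, ℝ)) (M := N × ℝ) (I' := I') (N := N))
          (isSpacelikeImmersion_cylSlice G hG t)).scalarCurvature z +
        3 * (G.inducedMetric (fun y : N ↦ ((y, t) : N × ℝ))
          (contMDiff_pullbackBilin_holds (I := I'.prod 𝓘(ℝ, ℝ)) (M := N × ℝ) (I' := I') (N := N))
          (isSpacelikeImmersion_cylSlice G hG t)).normSq z
          (G.secondFundamentalForm I' (fun y : N ↦ ((y, t) : N × ℝ))
            (fun y ↦ velocity (I'.prod 𝓘(ℝ, ℝ)) (fun s : ℝ ↦ ((y, s) : N × ℝ)) t) z) -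
        G.meanCurvature (fun y : N ↦ ((y, t) : N × ℝ))
          (contMDiff_pullbackBilin_holds (I := I'.prod 𝓘(ℝ, ℝ)) (M := N × ℝ) (I' := I') (N := N))
          (isSpacelikeImmersion_cylSlice G hG t)
          (fun y ↦ velocity (I'.prod 𝓘(ℝ, ℝ)) (fun s : ℝ ↦ ((y, s) : N × ℝ)) t) z ^ 2 -
        ∑ i, deriv (fun τ ↦ deriv (fun σ ↦ G.val (z, σ)
            ((β i, 0) : TangentSpace (I'.prod 𝓘(ℝ, ℝ)) (z, σ))
            ((β i, 0) : TangentSpace (I'.prod 𝓘(ℝ, ℝ)) (z, σ))) τ) t /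
          G.val (z, t) ((β i, 0) : TangentSpace (I'.prod 𝓘(ℝ, ℝ)) (z, t))
            ((β i, 0) : TangentSpace (I'.prod 𝓘(ℝ, ℝ)) (z, t)) := by
  set hpb := contMDiff_pullbackBilin_holds (I := I'.prod 𝓘(ℝ, ℝ)) (M := N × ℝ) (I' := I') (N := N)
    (n := (∞ : ℕ∞ω)) with hpb_def
  have hfi := isSpacelikeImmersion_cylSlice G hG t
  have hν := contMDiff_lift_velocity_cylSlice (I' := I') (N := N) t
  have hun := isUnitNormal_cylSlice G hcyl t
  have hm1 : Module.finrank ℝ (E' × ℝ) = Module.finrank ℝ E' + 1 := finrank_cylModel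
  have hGauss := scalarCurvature_eq_of_inducedMetric_general G hpb hfi hν hun rfl hm1 z
  rw [velocity_cylLine] at hGauss
  have htr := cyl_sum_riccati_div_eq G hG hcyl z t hm β hβ
  have hdd : ∀ i, deriv (fun τ ↦ deriv (fun σ ↦ G.val (z, σ)
      ((β i, 0) : TangentSpace (I'.prod 𝓘(ℝ, ℝ)) (z, σ))
      ((β i, 0) : TangentSpace (I'.prod 𝓘(ℝ, ℝ)) (z, σ))) τ) t = _ := fun i ↦
    (hasDerivAt_deriv_cyl_val_self G hcyl z t (β i)).deriv
  simp only [hdd]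
  have hsum : ∑ i, 2 * (G.val (z, t)
      (G.leviCivita.curvature (z, t) (((0 : E'), (1 : ℝ)) : TangentSpace (I'.prod 𝓘(ℝ, ℝ)) (z, t))
        ((β i, 0) : TangentSpace (I'.prod 𝓘(ℝ, ℝ)) (z, t))
        (((0 : E'), (1 : ℝ)) : TangentSpace (I'.prod 𝓘(ℝ, ℝ)) (z, t)))
      ((β i, 0) : TangentSpace (I'.prod 𝓘(ℝ, ℝ)) (z, t)) +
      G.val (z, t)
        (G.normalDerivAlong (I' := I') (fun y : N ↦ ((y, t) : N × ℝ))
          (fun y ↦ velocity (I'.prod 𝓘(ℝ, ℝ)) (fun s : ℝ ↦ ((y, s) : N × ℝ)) t) z (β i))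
        (G.normalDerivAlong (I' := I') (fun y : N ↦ ((y, t) : N × ℝ))
          (fun y ↦ velocity (I'.prod 𝓘(ℝ, ℝ)) (fun s : ℝ ↦ ((y, s) : N × ℝ)) t) z (β i))) /
      G.val (z, t) ((β i, 0) : TangentSpace (I'.prod 𝓘(ℝ, ℝ)) (z, t))
        ((β i, 0) : TangentSpace (I'.prod 𝓘(ℝ, ℝ)) (z, t)) =
      2 * (-G.ricci (z, t) (((0 : E'), (1 : ℝ)) : TangentSpace (I'.prod 𝓘(ℝ, ℝ)) (z, t))
          (((0 : E'), (1 : ℝ)) : TangentSpace (I'.prod 𝓘(ℝ, ℝ)) (z, t)) +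
        (G.inducedMetric (fun y : N ↦ ((y, t) : N × ℝ)) hpb hfi).normSq z
          (G.secondFundamentalForm I' (fun y : N ↦ ((y, t) : N × ℝ))
            (fun y ↦ velocity (I'.prod 𝓘(ℝ, ℝ)) (fun s : ℝ ↦ ((y, s) : N × ℝ)) t) z)) := by
    rw [← htr, Finset.mul_sum]
    refine Finset.sum_congr rfl fun i _ ↦ ?_
    rw [mul_div_assoc]
  rw [hsum, hGauss]
  ring

end Literature.Geometry.Riemannian
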